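import Summits.BirchSwinnertonDyer.BirchSwinnertonDyer.Theorems.GenusKolyvaginAtTwoShaCardDvdPowAtTwoRTUnramifiedParametrizationFrob
import Summits.BirchSwinnertonDyer.BirchSwinnertonDyer.Theorems.GenusKolyvaginAtTwoShaCardDvdPowAtTwoRTSingularParametrizationFrob
import Summits.BirchSwinnertonDyer.BirchSwinnertonDyer.Theorems.GenusKolyvaginAtTwoShaCardDvdPowAtTwoRTRegularFrameCoinvariants
import HarnessLib

/-!
# Route `GenusKolyvaginAtTwo`, crux U_T `ShaCardDvdPowAtTwoRT` (stmt-BirchSwinnertonDyer-23658; upper half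
# `#Ш(E/K)[2^∞] ∣ 2^(2M₀)`) — THE CYCLIC LOCAL FRAME: for a finite unramified module on which an (arithmetic) Frobenius acts as a REGULAR
# INVOLUTION and `2^M ∣ q + 1`, BOTH `H¹_ur(F, W)` and `H¹(F, W)/H¹_ur(F, W)` are CYCLIC of order `2^M`

Seat `bsd-line-gk2-p3` g25 (PROVER seat 3/3, cell `bsd-f1-sign2`), `--supports stmt-BirchSwinnertonDyer-23658` (helper; closes nothing).
THEOREMS ONLY (no definition, no named fact, no `sorry`): assembly of `…RTUnramifiedParametrizationFrob` (p744060: `H¹_ur ≅ W/(φ−1)W`),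
`…RTSingularParametrizationFrob` (p744286: `H¹/H¹_ur ≅ W^{φ=q}`), `…RTRegularFrameCoinvariants` (p743882) and the LEAD's `…RTEigenNorms`.
BSD is NOT proved by any of this; neither is U_T nor any stub.

WHY (seat memo `Cruxes/ShaCardDvdPowAtTwoRT/Lines/norm-sharp-upper-gk2p3.md` §4/§10/§13: stub «ℚ_ℓ cyclic local duality» of the twin-descent line for
U_T).  At `p` odd the local conditions at a Kolyvagin prime split into free rank-one `τ`-EIGENLINES (Howard H.5(a)); at `p = 2` over `K_λ` they
do not, and McCallum's Lemma 5.3 loses a bit.  Over `ℚ_ℓ` (`ℓ` inert Kolyvagin for `2`, `2^M ∣ ℓ+1`, `Frob_ℓ` acting on `E[2^M]` as a complex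
conjugation `c₀`, regular on `Δ < 0`) the two sides of the local frame are the COINVARIANTS and the ANTI-INVARIANTS of a free `ℤ/2^M[C₂]`-module —
both cyclic of order `2^M`: this file, for any such `(F, W, φ)`, with the Frobenius action displayed as a regular involution.
* `unramified_cyclic_of_regular_frobenius` — `H¹_ur(F, W) = ℤ·u₀`, `u₀ = unr P₀` (value `P₀` at `φ`), `a•u₀ = 0 ⟺ 2^M ∣ a`.
* `singular_cyclic_of_regular_frobenius` — `sing : H¹(F, W) → W`, kernel `H¹_ur`, values exactly `ℤ·(P₀ − φP₀)`, an element of order `2^M`.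
What the E-specialisation still needs (bookkeeping, memo §13): inertia-triviality of `E[2^M]` at good `ℓ ∤ 2` (tree:
`restrictField_torsionGaloisModule_apply_of_mem_absInertia`), `#E[2^M] = 4^M` coprime to `ℓ`, and «the local arithmetic Frobenius acts on `E[2^M]`
as a complex conjugation» from `FrobEqFrobInfty` (K-side model `torsionMap_liftAutPlace_eq_transport_conj`) + `exists_regular_generator_of_Δ_neg`.

References: [McCallumLMS1991] §4 Prop. 4.4, §5 Lemma 5.3; [Rubin2000] Lemma 1.3.2; [MazurRubinMemoirs2004] Lemma 1.2.1;
[Howard2004HeegnerKolyvagin] §1.3 H.5(a), Prop. 1.1.7, Lemma 1.5.3.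
-/

set_option autoImplicit false

-- the Theorems namespace of this sub repeats the summit name by design (D-0017 nested layout)
set_option linter.dupNamespace false

noncomputable section

open Function Field ValuativeRel
open scoped Classical

namespace Summit.BirchSwinnertonDyer.BirchSwinnertonDyer.Theorems.GenusExact.PlusDescent

section CyclicFrame

open Literature.NumberTheory.GaloisRepresentations
open Literature.NumberTheory.GaloisRepresentations.DiscreteGaloisModule
open Literature.NumberTheory.GaloisRepresentations.IsNonarchimedeanLocalField

variable {F : Type} [Field F] [ValuativeRel F] [TopologicalSpace F] [IsNonarchimedeanLocalField F]
variable {W : Type} [AddCommGroup W] [TopologicalSpace W] [DiscreteTopology W] [Finite W]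
  (ρ : DiscreteGaloisModule F W)

/-- **THE CYCLIC LOCAL FRAME — unramified side.**  `W` finite discrete with inertia acting trivially, `φ` a Frobenius lift acting on `W` as a
REGULAR INVOLUTION (`W = ℤP₀ ⊕ ℤ·φP₀` free over `ℤ/2^M`, `2^M P₀ = 0`, `φ² = 1` on `W`): then `H¹_ur(F, W)` is CYCLIC of order `2^M`, generated by
the unramified class `u₀ = unr P₀` with value `P₀` at `φ`: every unramified class is `a • u₀`, and `a • u₀ = 0 ⟺ 2^M ∣ a`
(`H¹_ur ≅ W/(φ−1)W`, p744060, and the coinvariants of the regular frame, p743882).  For `W = E[2^M]` over `ℚ_ℓ` at an inert Kolyvagin prime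
for `2` on `Δ < 0`: the `p = 2` replacement of «`H¹_f(ℚ_ℓ, E[p^M])` is a free rank-one `+`-eigenline». [cite: McCallumLMS1991, §4 Prop. 4.4, §5 Lemma 5.3]
[cite: Rubin2000, Lemma 1.3.2] -/
theorem unramified_cyclic_of_regular_frobenius (htrivI : ∀ τ ∈ absInertia F, ∀ w : W, ρ τ w = w)
    {φ : absoluteGaloisGroup F} (hφ : IsFrobPow φ 1) {M : ℕ} (P₀ : W)
    (hspan : ∀ Q : W, ∃ a b : ℤ, Q = a • P₀ + b • ρ φ P₀)
    (hfree : ∀ a b : ℤ, a • P₀ + b • ρ φ P₀ = 0 → (2 ^ M : ℤ) ∣ a ∧ (2 ^ M : ℤ) ∣ b)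
    (htor : (2 ^ M : ℤ) • P₀ = 0) (hinv : ∀ x : W, ρ φ (ρ φ x) = x) :
    ∃ unr : W →+ galoisCohomology ρ 1,
      (∀ w, unr w ∈ DiscreteGaloisModule.unramifiedSubgroup ρ 1) ∧
      (∀ c ∈ DiscreteGaloisModule.unramifiedSubgroup ρ 1, ∃ a : ℤ, c = a • unr P₀) ∧
      (∀ a : ℤ, a • unr P₀ = 0 ↔ (2 ^ M : ℤ) ∣ a) ∧
      (∃ z : contOneCocycles ρ.toTopRep, (∀ n : absInertia F, z.1 n = 0) ∧ z.1 φ = P₀ ∧ oneCocycleClass ρ.toTopRep z = unr P₀) := by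
  obtain ⟨unr, hmem, hsurj, hker, hrep⟩ := exists_unramified_parametrization_of_inertia_trivial ρ htrivI hφ
  set t : W →+ W := (ρ φ).toAddMonoidHom with ht
  have htapp : ∀ x, t x = ρ φ x := fun _ ↦ rfl
  have hτ : ∀ x, t (t x) = x := fun x ↦ by rw [htapp, htapp, hinv]
  have hspan' : ∀ Q : W, ∃ a b : ℤ, Q = a • P₀ + b • t P₀ := hspan
  have hfree' : ∀ a b : ℤ, a • P₀ + b • t P₀ = 0 → (2 ^ M : ℤ) ∣ a ∧ (2 ^ M : ℤ) ∣ b := hfree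
  refine ⟨unr, hmem, fun c hc ↦ ?_, fun a ↦ ?_, ?_⟩
  · obtain ⟨w, rfl⟩ := hsurj c hc
    obtain ⟨a, y, rfl⟩ := exists_eq_zsmul_add_tau_sub t P₀ hspan' w
    refine ⟨a, ?_⟩
    have h0 : unr (t y - y) = 0 := (hker _).mpr ⟨y, by rw [htapp]⟩
    rw [map_add, h0, add_zero, map_zsmul]
  · rw [← map_zsmul, hker]
    constructor
    · rintro ⟨v, hv⟩
      exact two_pow_dvd_of_zsmul_eq_tau_sub t hτ P₀ hspan' hfree' (y := v) (by rw [htapp]; exact hv)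
    · rintro ⟨m, rfl⟩
      exact ⟨0, by rw [map_zero, sub_zero, mul_comm, mul_zsmul, htor, zsmul_zero]⟩
  · obtain ⟨z, hzI, hzφ, hz⟩ := hrep P₀
    exact ⟨z, hzI, hzφ, hz⟩

/-- **THE CYCLIC LOCAL FRAME — singular side.**  Same setting, with `#W` prime to the residue characteristic, `φ` an ARITHMETIC Frobenius and
`2^M ∣ q + 1` (the Kolyvagin congruence at `2`: `q ≡ −1`): then `H¹(F, W)/H¹_ur(F, W)` is CYCLIC of order `2^M` — the evaluation `sing` at a tame
generator (p744286: kernel `= H¹_ur`, image `= W^{φ=q}`) takes values in `W^{φ=q} = W^{φ=−1} = ℤ·(P₀ − φP₀)` (LEAD's `exists_eq_zsmul_conorm_of_tau_eq_neg`),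
an element of order `2^M` (`addOrderOf_conorm_eq`), and attains every multiple of it.  For `W = E[2^M]` over `ℚ_ℓ` at an inert Kolyvagin prime
for `2` on `Δ<0`: the `p = 2` replacement of «`H¹_s(ℚ_ℓ, E[p^M])` is a free rank-one eigenline» — with the unramified side, McCallum's Lemma 5.3
has CYCLIC groups on both sides of the local duality over `ℚ_ℓ`, so no bit is lost. [cite: McCallumLMS1991, §5 Lemma 5.3]
[cite: Rubin2000, Lemma 1.3.2] [cite: MazurRubinMemoirs2004, Lemma 1.2.1] -/
theorem singular_cyclic_of_regular_frobenius (htrivI : ∀ τ ∈ absInertia F, ∀ w : W, ρ τ w = w)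
    (hW : (Nat.card W).Coprime (ringChar 𝓀[F])) {φ : absoluteGaloisGroup F} (hφ : IsAbsArithFrob φ) {M : ℕ} (P₀ : W)
    (hspan : ∀ Q : W, ∃ a b : ℤ, Q = a • P₀ + b • ρ φ P₀)
    (hfree : ∀ a b : ℤ, a • P₀ + b • ρ φ P₀ = 0 → (2 ^ M : ℤ) ∣ a ∧ (2 ^ M : ℤ) ∣ b)
    (htor : (2 ^ M : ℤ) • P₀ = 0) (hinv : ∀ x : W, ρ φ (ρ φ x) = x) (hq : 2 ^ M ∣ residueFieldCard F + 1) :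
    ∃ (σ₀ : absInertia F) (sing : galoisCohomology ρ 1 →+ W),
      (∀ z : contOneCocycles ρ.toTopRep, sing (oneCocycleClass ρ.toTopRep z) = z.1 (σ₀ : absoluteGaloisGroup F)) ∧
      (∀ c, sing c = 0 ↔ c ∈ DiscreteGaloisModule.unramifiedSubgroup ρ 1) ∧
      (∀ c, ∃ a : ℤ, sing c = a • (P₀ - ρ φ P₀)) ∧
      (∀ a : ℤ, ∃ c, sing c = a • (P₀ - ρ φ P₀)) ∧
      addOrderOf (P₀ - ρ φ P₀) = 2 ^ M := by
  obtain ⟨σ₀, sing, hsing, hker, hrel, hsurj⟩ := exists_singular_parametrization_of_inertia_trivial ρ htrivI hW hφ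
  set t : W →+ W := (ρ φ).toAddMonoidHom with ht
  have htapp : ∀ x, t x = ρ φ x := fun _ ↦ rfl
  have hτ : ∀ x, t (t x) = x := fun x ↦ by rw [htapp, htapp, hinv]
  have hspan' : ∀ Q : W, ∃ a b : ℤ, Q = a • P₀ + b • t P₀ := hspan
  have hfree' : ∀ a b : ℤ, a • P₀ + b • t P₀ = 0 → (2 ^ M : ℤ) ∣ a ∧ (2 ^ M : ℤ) ∣ b := hfree
  -- `2^M` kills `W`, hence `q • a = -a` on `W`
  have hkill : ∀ a : W, (2 ^ M : ℤ) • a = 0 := fun a ↦ by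
    obtain ⟨α, β, rfl⟩ := hspan' a
    rw [zsmul_add, smul_smul, smul_smul, mul_comm, mul_zsmul, htor, zsmul_zero, zero_add, mul_comm, mul_zsmul, ← map_zsmul, htor,
      map_zero, zsmul_zero]
  have hqneg : ∀ a : W, residueFieldCard F • a = -a := fun a ↦ by
    obtain ⟨m, hm⟩ := hq
    have h1 : (residueFieldCard F + 1) • a = 0 := by
      rw [hm, mul_comm, mul_nsmul, ← natCast_zsmul, Nat.cast_pow, Nat.cast_ofNat, hkill]
    rwa [add_nsmul, one_nsmul, add_eq_zero_iff_eq_neg] at h1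
  refine ⟨σ₀, sing, hsing, hker, fun c ↦ ?_, fun a ↦ ?_, ?_⟩
  · -- `φ (sing c) = q • sing c = - sing c`, so `sing c` is a conorm multiple
    have hneg : t (sing c) = -sing c := by rw [htapp, hrel, hqneg]
    obtain ⟨a, ha⟩ := exists_eq_zsmul_conorm_of_tau_eq_neg t hτ P₀ hspan' hfree' htor hneg
    exact ⟨a, by rw [ha, htapp]⟩
  · -- every conorm multiple is anti-invariant, hence in the image
    have hanti : ρ φ (a • (P₀ - ρ φ P₀)) = residueFieldCard F • (a • (P₀ - ρ φ P₀)) := by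
      rw [hqneg, map_zsmul, map_sub, hinv, ← zsmul_neg, neg_sub]
    exact hsurj _ hanti
  · have h := addOrderOf_conorm_eq t P₀ hfree' htor
    rwa [htapp] at h

end CyclicFrame

end Summit.BirchSwinnertonDyer.BirchSwinnertonDyer.Theorems.GenusExact.PlusDescent

end
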